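import Literature.Barriers.CriticalPhenomena.RandomClusterFirstOrder
import HarnessLib

/-!
# Barrier: on `ℤ²` the random-cluster transition is DISCONTINUOUS exactly for `q > 4` — Duminil-Copin–Gagnebin–Harel–Manolescu–Tassion 2021 / Duminil-Copin–Sidoravicius–Tassion 2017

Barrier catalogue `Literature/Barriers/CriticalPhenomena/` (D-0021), entry for the conjunct `PercolationContinuityZ3`;
companion of `RandomClusterFirstOrder` (Grimmett 2006 Thm. (7.33)(b): `θ¹(p_c(q), q) > 0` for `q > Q(d)`, `d ≥ 2`,
threshold `Q(d)` INEXPLICIT).  This file records the planar case, where the threshold is EXPLICIT and SHARP: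

* Duminil-Copin, Gagnebin, Harel, Manolescu, Tassion, *Discontinuity of the phase transition for the planar random-cluster
  and Potts models with `q > 4`*, Ann. Sci. ÉNS 54 (2021) 1363–1413 (arXiv:1611.09877), Thm. 1.2: "Consider the random-cluster
  model on the square lattice with `q > 4`. Then • `φ¹_{ℤ²,p_c,q} ≠ φ⁰_{ℤ²,p_c,q}`; • `φ¹_{ℤ²,p_c,q}[there exists an infinite
  cluster] = 1`; • [exponential decay of `φ⁰_{ℤ²,p_c,q}[0 ↔ x_n]` with the explicit rate]."
* Duminil-Copin, Sidoravicius, Tassion, *Continuity of the phase transition for planar random-cluster and Potts models with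
  `1 ≤ q ≤ 4`*, Comm. Math. Phys. 349 (2017) 47–107 (arXiv:1505.04159), Thm. 2: "Let `q ∈ [1,4]`, then
  `φ¹_{ℤ²,p_c(q),q}[0 ↔ ∞] = 0`."

Why it matters for the `θ(p_c) = 0` programme (located by seat prim-postcont-3, bschramm/postcont FK-PLAN.md §36, 2026-08-20):
the lane's planar corollary `θ_{ℤ²}(p_c) = 0` obtained WITHOUT RSW through near-one gluing (`Transplant/BoxProdZ2AllFibres.lean`,
`bsConj4_boxProdZ2_all`) has a wired random-cluster transplant all of whose hypotheses hold for every `q ≥ 1` and whose conclusion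
is FALSE for every `q > 4` — the cleanest "must-fail" instance of the chain, with an explicit threshold and `d = 2`; so the
transplant must break at the `q = 1`-only identities of block (D) (locality / restriction / continuity in `p` of infinite-volume
cylinder probabilities; bschramm/FK-BARRIER.md §0), exactly as in `d = 3` but now with no appeal to an inexplicit `Q(d)`.

## Contents

* `RandomClusterPlanarDiscontinuity` — the named fact (barrier), `q > 4`: `θ¹(p_c(q), q) > 0` on `ℤ²`, with the tree's
  `thetaWired 2 p q` (`= inf_n φ¹_{Λ_n,p,q}(0 ↔ ∂Λ_n)`) and `rcCriticalProb 2 q` of `RandomClusterFirstOrder`;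
* `RandomClusterPlanarContinuity` — the companion named fact, `1 ≤ q ≤ 4`: `θ¹(p_c(q), q) = 0` on `ℤ²`;
* `RandomClusterPlanarDiscontinuity.not_uniform` — under the barrier, no statement "`θ¹(p_c(q), q) = 0` for all `q ≥ 1` on `ℤ²`"
  can be a theorem; `randomClusterPlanar_dichotomy` — the two facts together decide continuity on `[1, ∞)` by the sign of `q − 4`.

## References

* H. Duminil-Copin, M. Gagnebin, M. Harel, I. Manolescu, V. Tassion, Ann. Sci. Éc. Norm. Supér. (4) 54 (2021) 1363–1413, Thm. 1.2.
* H. Duminil-Copin, V. Sidoravicius, V. Tassion, Comm. Math. Phys. 349 (2017) 47–107, Thm. 2 (and Thm. 3, P1 ⟺ P1').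
* G. Grimmett, *The Random-Cluster Model*, Springer 2006: Thm. (4.19)(b) (translation invariance of `φ¹`), Prop. (5.11)
  (`θ¹` as a limit over boxes), Thm. (6.35) and Conj. (6.32) (the planar picture), Thm. (7.33).
-/

noncomputable section

namespace Literature.Barriers.CriticalPhenomena

open Literature.Probability.LatticeModels

/-- **BARRIER — the planar random-cluster transition is discontinuous for `q > 4` (Duminil-Copin–Gagnebin–Harel–Manolescu–Tassion
2021, Thm. 1.2).** As printed: "Consider the random-cluster model on the square lattice with `q > 4`. Then `φ¹_{ℤ²,p_c,q} ≠ φ⁰_{ℤ²,p_c,q}`;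
`φ¹_{ℤ²,p_c,q}[there exists an infinite cluster] = 1`; …".  Vendored: for every real `q > 4`, `θ¹(p_c(q), q) > 0` on `ℤ²`
(`thetaWired 2`, `rcCriticalProb 2` of `RandomClusterFirstOrder`) — the second item together with the translation invariance of
`φ¹` (an infinite cluster exists a.s. iff `φ¹[x ↔ ∞] > 0` for some, hence every, `x`).

BARRIER (D-0021 structured block):
- technique_class: random-cluster q-uniform planar wired-phase boundary-condition-insensitive near-one-gluing same-p transplant FKG monotone-measure sharp-threshold
- blocks: proofs of `θ_{ℤ²}(p_c) = 0` (and of any statement implying it, e.g. the `X = K₁` / finite-fibre instances of the lane's product node `Transplant/BoxProdZ2AllFibres.lean`) by arguments every step of which holds for the WIRED random-cluster measure `φ¹_{p,q}` on `ℤ²` for every `q ≥ 1` (FKG, comparison, finite energy, sharpness, uniqueness for `p ≠ p_c`, `p_c(q) < 1`, finite tubes subcritical): such an argument would give `θ¹(p_c(q), q) = 0` for `q > 4`, contradicting Thm. 1.2 [cite: DuminilCopinGagnebinHarelManolescuTassion2021, Thm. 1.2]; unlike `RandomClusterFirstOrder` the threshold is explicit (`q > 4`) and the dimension is `2`.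
- because: for `q > 4` the six-vertex / Bethe-ansatz computation of the free energy of the critical random-cluster model on `ℤ²` gives a positive inverse correlation length under `φ⁰_{p_c,q}` (exponential decay of `φ⁰_{p_c,q}[0 ↔ x]`), which by duality (`p_c(q) = √q/(1+√q)` is the self-dual point [cite: BeffaraDuminilCopin2012, Thm. 1]) forces `φ¹_{p_c,q}` to percolate and `φ¹_{p_c,q} ≠ φ⁰_{p_c,q}` [cite: DuminilCopinGagnebinHarelManolescuTassion2021, Thm. 1.2 and §1.3 (strategy)].
- evasions_known: `q`-specific input: for `1 ≤ q ≤ 4` the planar transition IS continuous, `φ¹_{p_c(q),q}[0 ↔ ∞] = 0` [cite: DuminilCopinSidoraviciusTassionCMP2017, Thm. 2] (parafermionic observable + RSW-type crossing estimates that use `q ≤ 4`), so arguments using an input valid only for `q ≤ 4` (or only for `q = 1`: independence / locality of the product measure — the block-(D) identities of bschramm/FK-BARRIER.md §0, e.g. tree `prodBernoulli_real_eq_of_determinedBy`, `bondPercolation_map_comap`) are not blocked; FREE-measure / from-below arguments are not blocked either: `θ⁰(p_c(q), q) = 0` on `ℤ²` for ALL `q ≥ 1` [cite: Grimmett2006,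 Thm. (6.17)(a)].
- scope_caveats: `d = 2` (square lattice) only; `θ¹` is DEFINED as the infimum over boxes of `φ¹_{Λ_n,p,q}(0 ↔ ∂Λ_n)` (`thetaWired`, equal to the book's `θ¹ = lim` by [cite: Grimmett2006, Prop. (5.11)], identification informal since the infinite-volume measures are not in the tree) and `p_c(q)` via `θ¹` (`rcCriticalProb`); the printed second item "`φ¹[∃ infinite cluster] = 1`" is vendored as `θ¹(p_c(q), q) > 0` (equivalent by translation invariance of `φ¹` [cite: Grimmett2006, Thm. (4.19)(b)] and countable additivity); the first and third items of Thm. 1.2 (non-uniqueness, the explicit correlation length) are not vendored.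
- status: established (theorem [cite: DuminilCopinGagnebinHarelManolescuTassion2021, Thm. 1.2]; short alternative proof Ray–Spinka 2020); named fact, not proved in the tree.

Users take `(h : RandomClusterPlanarDiscontinuity)`.
[cite: DuminilCopinGagnebinHarelManolescuTassion2021, Thm. 1.2] -/
def RandomClusterPlanarDiscontinuity : Prop :=
  ∀ q : ℝ, 4 < q → 0 < thetaWired 2 (rcCriticalProb 2 q) q

/-- **Continuity of the planar random-cluster transition for `1 ≤ q ≤ 4` (Duminil-Copin–Sidoravicius–Tassion 2017, Thm. 2).**
As printed: "Let `q ∈ [1,4]`, then `φ¹_{ℤ²,p_c(q),q}[0 ↔ ∞] = 0`."  Vendored with the tree's `thetaWired 2` / `rcCriticalProb 2`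
(`θ¹ = inf_n φ¹_{Λ_n}(0 ↔ ∂Λ_n)`, Grimmett 2006 Prop. (5.11)).  The companion (evasion side) of `RandomClusterPlanarDiscontinuity`:
together they say that on `ℤ²` the transition is continuous iff `q ≤ 4` (Baxter's prediction).  Named fact, not proved in the tree;
users take `(h : RandomClusterPlanarContinuity)`. [cite: DuminilCopinSidoraviciusTassionCMP2017, Thm. 2] -/
def RandomClusterPlanarContinuity : Prop :=
  ∀ q : ℝ, 1 ≤ q → q ≤ 4 → thetaWired 2 (rcCriticalProb 2 q) q = 0

/-! ### API -/

/-- The barrier in the form it meets a `q`-uniform planar argument: under Thm. 1.2, "`θ¹(p_c(q), q) = 0` for every `q ≥ 1` on `ℤ²`"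
is false (take `q = 5`). [cite: DuminilCopinGagnebinHarelManolescuTassion2021, Thm. 1.2] -/
theorem RandomClusterPlanarDiscontinuity.not_uniform (h : RandomClusterPlanarDiscontinuity) :
    ¬ ∀ q : ℝ, 1 ≤ q → thetaWired 2 (rcCriticalProb 2 q) q = 0 := by
  intro hall
  have h5 := h 5 (by norm_num)
  rw [hall 5 (by norm_num)] at h5
  exact lt_irrefl 0 h5

/-- **Baxter's dichotomy on `ℤ²`** (from the two named facts): for `q ≥ 1`, `θ¹(p_c(q), q) = 0 ↔ q ≤ 4`.
[cite: DuminilCopinGagnebinHarelManolescuTassion2021, Thm. 1.2] -/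
theorem randomClusterPlanar_dichotomy (hd : RandomClusterPlanarDiscontinuity) (hc : RandomClusterPlanarContinuity)
    {q : ℝ} (hq : 1 ≤ q) : thetaWired 2 (rcCriticalProb 2 q) q = 0 ↔ q ≤ 4 := by
  constructor
  · intro h0
    by_contra h4
    have hpos := hd q (lt_of_not_ge h4)
    rw [h0] at hpos
    exact lt_irrefl 0 hpos
  · exact hc q hq

end Literature.Barriers.CriticalPhenomena
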